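import Summits.NavierStokesRegularity.OSWSelfSimilar.SheetRPerturbedPair
import Literature.Analysis.OperatorTheory.PseudoResolvent
import HarnessLib

/-!
# SHEET-ℝ frame, (P1) for the FULL operator `A = (−∂² + d∂ + V) + K`: the COMPLEX resolvent `R_K(σ) : L²_w(ℂ) →L[ℂ] L²_w(ℂ)` on
# `Re σ > −m`, its weak meaning, uniqueness, and the pseudo-resolvent structure (cert-1's `𝒜(σ)⁻¹J` for `A_F = B_λ − P + F`)

HONEST FRAMING (cell ns-blowup GROUP B / zone Z3, case Z3-SR-SPEC, PAPER item (P1) «`(A_F + σJ)⁻¹J` exists as a bounded operator on `L²_w`,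
analytic on `Re σ > −(c₁ + γ)`» of SHEET-R-SPEC-PRICE-impl1 (S3); 1-D MODEL certificate frame (viscous gCLM/OSW sheet on the line); not Euler/NS;
«violates: none — MODEL»). Nothing here asserts that a profile exists; the Gårding datum of the PERTURBED form ((S1), interval arithmetic) is
the HYPOTHESIS `GardingDataK`, and `K : Esp L hL →L[ℝ] W L` is arbitrary (cert-1: `K = −P + F`).

Same construction as `SheetRResolventComplex` / `SheetRResolventIdentity` with the perturbed pair solution operator of
`SheetRPerturbedPair.exists_pairSolutionOperatorK` and the perturbed uniqueness `SheetRPerturbedUniqueness.pair_eq_zero_of_weakK`: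
`pairOpK` (choice) / `pairOpK_unique` / `pairOpK_rot`; `resolventK σ : Wc L →L[ℂ] Wc L` (`ℂ`-linear by the rotation lemma; `0` outside the
half-plane, junk value); `resolventK_weak`; `norm_resolventK_le` (`≤ 8/κ(σ)`); `resolventK_absorb`, `resolventK_sub` (first resolvent identity),
**`isPseudoResolventK : IsPseudoResolvent {Re σ > −m} (resolventK hL K h)`** and `differentiableOn_resolventK`.  KERNEL CAVEAT as before: tests
are odd, so `R_K(σ)` is the resolvent ON THE ODD CLASS and a pseudo-resolvent on all of `L²_w(ℂ)`.
Three definitions (`pairOpK`, `resolventRK`, `resolventK`); no named fact.  WHAT THIS IS NOT: not NS; not the spectral certificate; no number of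
record moves.
-/

noncomputable section

namespace Summit.NavierStokesRegularity.OSWSelfSimilar
namespace SheetRPerturbedResolvent

open _root_.MeasureTheory _root_.Set _root_.Filter _root_.Real SheetRWeakProfilePV SheetRWeakToStrong SheetREnergyClass SheetRWeightedMeasure
  SheetRLinearisedTests SheetREnergySpace SheetRTestSpace SheetRLinearisedFormBounds SheetRSolutionOperator SheetRLinearisedCutoffEnergy
  SheetRResolventPair SheetRComplexPivot SheetRResolventComplex SheetRPerturbedUniqueness SheetRPerturbedPair Literature.Analysis.OperatorTheory
open scoped Topology ENNReal

variable {L D₀ D₁ V₀ m : ℝ} {d V : ℝ → ℝ}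

/-! ### §1 The perturbed pair solution operator at `σ`, and its uniqueness -/

/-- **The perturbed pair solution operator** at `σ` (`Re σ > −m`), by choice. [folklore] -/
def pairOpK (hL : 0 < L) (K : Esp L hL →L[ℝ] W L) (h : GardingDataK L hL d V K D₀ D₁ V₀ m) (σ : ℂ) (hσ : -m < σ.re) :
    WithLp 2 (W L × W L) →L[ℝ] WithLp 2 (Esp L hL × Esp L hL) :=
  Classical.choose (exists_pairSolutionOperatorK hL K h.d_meas (shift_hypsK h σ.re).1 h.D₁_nonneg h.d_le (shift_hypsK h σ.re).2 σ.im
    (kappa_pos_le hσ).1 (coerciveK_shift h hσ))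

/-- The defining property of `pairOpK`: the perturbed weak pair system (potential `V + Re σ`, coupling `Im σ`) and the bound
`‖pairOpK σ G‖ ≤ (4/κ(σ))‖G‖`. [folklore] -/
theorem pairOpK_spec (hL : 0 < L) (K : Esp L hL →L[ℝ] W L) (h : GardingDataK L hL d V K D₀ D₁ V₀ m) (σ : ℂ) (hσ : -m < σ.re) :
    (∀ (G : WithLp 2 (W L × W L)) (v v₁ : ℝ → ℝ), IsCompactTest v v₁ →
        linForm L d (fun ξ => V ξ + σ.re) (prim (der (pairOpK hL K h σ hσ G).fst)) (der (pairOpK hL K h σ hσ G).fst) v v₁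
              + (∫ y, (L ^ 2 + y ^ 2) * (((K (pairOpK hL K h σ hσ G).fst : W L) : ℝ → ℝ) y * v y))
              - σ.im * ∫ y, (L ^ 2 + y ^ 2) * (prim (der (pairOpK hL K h σ hσ G).snd) y * v y) =
            ∫ y, (L ^ 2 + y ^ 2) * ((G.fst : ℝ → ℝ) y * v y) ∧
          linForm L d (fun ξ => V ξ + σ.re) (prim (der (pairOpK hL K h σ hσ G).snd)) (der (pairOpK hL K h σ hσ G).snd) v v₁
              + (∫ y, (L ^ 2 + y ^ 2) * (((K (pairOpK hL K h σ hσ G).snd : W L) : ℝ → ℝ) y * v y))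
              + σ.im * ∫ y, (L ^ 2 + y ^ 2) * (prim (der (pairOpK hL K h σ hσ G).fst) y * v y) =
            ∫ y, (L ^ 2 + y ^ 2) * ((G.snd : ℝ → ℝ) y * v y)) ∧
      ∀ G : WithLp 2 (W L × W L), ‖pairOpK hL K h σ hσ G‖ ≤ 4 / min 1 (4 * (m + σ.re)) * ‖G‖ :=
  Classical.choose_spec (exists_pairSolutionOperatorK hL K h.d_meas (shift_hypsK h σ.re).1 h.D₁_nonneg h.d_le (shift_hypsK h σ.re).2 σ.im
    (kappa_pos_le hσ).1 (coerciveK_shift h hσ))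

/-- The left-hand sides of the perturbed pair system as values of the bundled maps (`Eform`, `Pdata`, `Bcpl`). [folklore] -/
theorem lhs_eq (hL : 0 < L) (K : Esp L hL →L[ℝ] W L) (h : GardingDataK L hL d V K D₀ D₁ V₀ m) (s t : ℝ) (p q : Esp L hL)
    (v v₁ : ℝ → ℝ) (hv : IsCompactTest v v₁) :
    linForm L d (fun ξ => V ξ + s) (prim (der p)) (der p) v v₁ + (∫ y, (L ^ 2 + y ^ 2) * (((K p : W L) : ℝ → ℝ) y * v y))
        - t * ∫ y, (L ^ 2 + y ^ 2) * (prim (der q) y * v y) =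
      Eform hL h.d_meas (shift_hypsK h s).1 h.D₁_nonneg h.d_le (shift_hypsK h s).2 p ⟨(v, v₁), hv⟩ + Pdata hL (K p) ⟨(v, v₁), hv⟩
        - t * Bcpl hL q ⟨(v, v₁), hv⟩ := by
  rw [Eform_apply, Pdata_apply, Bcpl_apply]

/-- **Uniqueness**: an energy-space pair solving the perturbed `σ`-system weakly with data `G` IS `pairOpK σ G`. [folklore] -/
theorem pairOpK_unique (hL : 0 < L) (K : Esp L hL →L[ℝ] W L) (h : GardingDataK L hL d V K D₀ D₁ V₀ m) (σ : ℂ) (hσ : -m < σ.re)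
    (G : WithLp 2 (W L × W L)) {Q : WithLp 2 (Esp L hL × Esp L hL)}
    (hQ : ∀ v v₁ : ℝ → ℝ, IsCompactTest v v₁ →
      linForm L d (fun ξ => V ξ + σ.re) (prim (der Q.fst)) (der Q.fst) v v₁
            + (∫ y, (L ^ 2 + y ^ 2) * (((K Q.fst : W L) : ℝ → ℝ) y * v y))
            - σ.im * ∫ y, (L ^ 2 + y ^ 2) * (prim (der Q.snd) y * v y) = ∫ y, (L ^ 2 + y ^ 2) * ((G.fst : ℝ → ℝ) y * v y) ∧
        linForm L d (fun ξ => V ξ + σ.re) (prim (der Q.snd)) (der Q.snd) v v₁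
            + (∫ y, (L ^ 2 + y ^ 2) * (((K Q.snd : W L) : ℝ → ℝ) y * v y))
            + σ.im * ∫ y, (L ^ 2 + y ^ 2) * (prim (der Q.fst) y * v y) = ∫ y, (L ^ 2 + y ^ 2) * ((G.snd : ℝ → ℝ) y * v y)) :
    Q = pairOpK hL K h σ hσ G := by
  set P := pairOpK hL K h σ hσ G with hP
  have hPs := (pairOpK_spec hL K h σ hσ).1 G
  obtain ⟨hVs, hVb⟩ := shift_hypsK h σ.re
  -- the difference solves the homogeneous perturbed pair system
  have hzero := pair_eq_zero_of_weakK hL h.d_meas hVs h.D₀_nonneg h.D₁_nonneg h.d_le hVb K (kappa_pos_le hσ).1 (coerciveK_shift h hσ) σ.im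
    (pR := (Q - P).fst) (pI := (Q - P).snd) (fun v v₁ hv => ?_) (fun v v₁ hv => ?_)
  · obtain ⟨h1, h2⟩ := hzero
    rw [WithLp.sub_fst, sub_eq_zero] at h1
    rw [WithLp.sub_snd, sub_eq_zero] at h2
    exact WithLp.ofLp_injective 2 (Prod.ext h1 h2)
  · rw [lhs_eq hL K h σ.re σ.im _ _ v v₁ hv, WithLp.sub_fst, WithLp.sub_snd, map_sub K, LinearMap.map_sub₂, LinearMap.map_sub₂,
      LinearMap.map_sub₂]
    have e1 := (hQ v v₁ hv).1
    have e2 := (hPs v v₁ hv).1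
    rw [lhs_eq hL K h σ.re σ.im _ _ v v₁ hv] at e1 e2
    linarith
  · have key : ∀ (p q : Esp L hL), linForm L d (fun ξ => V ξ + σ.re) (prim (der p)) (der p) v v₁
        + (∫ y, (L ^ 2 + y ^ 2) * (((K p : W L) : ℝ → ℝ) y * v y)) + σ.im * ∫ y, (L ^ 2 + y ^ 2) * (prim (der q) y * v y) =
        Eform hL h.d_meas hVs h.D₁_nonneg h.d_le hVb p ⟨(v, v₁), hv⟩ + Pdata hL (K p) ⟨(v, v₁), hv⟩ + σ.im * Bcpl hL q ⟨(v, v₁), hv⟩ := by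
      intro p q; rw [Eform_apply, Pdata_apply, Bcpl_apply]
    rw [key, WithLp.sub_fst, WithLp.sub_snd, map_sub K, LinearMap.map_sub₂, LinearMap.map_sub₂, LinearMap.map_sub₂]
    have e1 := (hQ v v₁ hv).2
    have e2 := (hPs v v₁ hv).2
    rw [key] at e1 e2
    linarith

/-- **Rotation**: `pairOpK σ (−g_I, g_R) = (−p_I, p_R)` — realified `ℂ`-linearity. [folklore] -/
theorem pairOpK_rot (hL : 0 < L) (K : Esp L hL →L[ℝ] W L) (h : GardingDataK L hL d V K D₀ D₁ V₀ m) (σ : ℂ) (hσ : -m < σ.re)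
    (G : WithLp 2 (W L × W L)) :
    pairOpK hL K h σ hσ (WithLp.toLp 2 (-G.snd, G.fst)) = WithLp.toLp 2 (-(pairOpK hL K h σ hσ G).snd, (pairOpK hL K h σ hσ G).fst) := by
  set Q := pairOpK hL K h σ hσ G with hQdef
  have hQ := (pairOpK_spec hL K h σ hσ).1 G
  symm
  refine pairOpK_unique hL K h σ hσ _ fun v v₁ hv => ?_
  obtain ⟨e1, e2⟩ := hQ v v₁ hv
  have hR1 : (WithLp.toLp 2 (-Q.snd, Q.fst) : WithLp 2 (Esp L hL × Esp L hL)).fst = -Q.snd := rfl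
  have hR2 : (WithLp.toLp 2 (-Q.snd, Q.fst) : WithLp 2 (Esp L hL × Esp L hL)).snd = Q.fst := rfl
  have hD1 : (WithLp.toLp 2 (-G.snd, G.fst) : WithLp 2 (W L × W L)).fst = -G.snd := rfl
  have hD2 : (WithLp.toLp 2 (-G.snd, G.fst) : WithLp 2 (W L × W L)).snd = G.fst := rfl
  rw [hR1, hR2, hD1, hD2]
  obtain ⟨hneg_ae, hneg_prim⟩ := der_neg hL Q.snd
  have hlin : linForm L d (fun ξ => V ξ + σ.re) (prim (der (-Q.snd))) (der (-Q.snd)) v v₁ =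
      -1 * linForm L d (fun ξ => V ξ + σ.re) (prim (der Q.snd)) (der Q.snd) v v₁ := by
    rw [linForm_congr_ae L d _ (Eventually.of_forall fun y => congrFun hneg_prim y) hneg_ae]
    exact linForm_smul_left L d _ (-1)
  have hcpl : ∫ y, (L ^ 2 + y ^ 2) * (prim (der (-Q.snd)) y * v y) = -1 * ∫ y, (L ^ 2 + y ^ 2) * (prim (der Q.snd) y * v y) := by
    rw [← integral_const_mul]
    refine integral_congr_ae (Eventually.of_forall fun y => ?_)
    show (L ^ 2 + y ^ 2) * (prim (der (-Q.snd)) y * v y) = -1 * ((L ^ 2 + y ^ 2) * (prim (der Q.snd) y * v y))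
    rw [congrFun hneg_prim y]; ring
  have hdat : ∫ y, (L ^ 2 + y ^ 2) * ((((-G.snd : W L)) : ℝ → ℝ) y * v y) = -1 * ∫ y, (L ^ 2 + y ^ 2) * ((G.snd : ℝ → ℝ) y * v y) := by
    rw [← integral_const_mul]
    refine integral_congr_ae ((ae_volume_of_ae_μw hL (Lp.coeFn_neg (G.snd : W L))).mono fun y hy => ?_)
    show (L ^ 2 + y ^ 2) * (((-G.snd : W L) : ℝ → ℝ) y * v y) = -1 * ((L ^ 2 + y ^ 2) * ((G.snd : ℝ → ℝ) y * v y))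
    rw [hy, Pi.neg_apply]; ring
  have hK : ∫ y, (L ^ 2 + y ^ 2) * (((K (-Q.snd) : W L) : ℝ → ℝ) y * v y) = -1 * ∫ y, (L ^ 2 + y ^ 2) * (((K Q.snd : W L) : ℝ → ℝ) y * v y) := by
    rw [← integral_const_mul, map_neg K]
    refine integral_congr_ae ((ae_volume_of_ae_μw hL (Lp.coeFn_neg (K Q.snd : W L))).mono fun y hy => ?_)
    show (L ^ 2 + y ^ 2) * (((-(K Q.snd) : W L) : ℝ → ℝ) y * v y) = -1 * ((L ^ 2 + y ^ 2) * (((K Q.snd : W L) : ℝ → ℝ) y * v y))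
    rw [hy, Pi.neg_apply]; ring
  refine ⟨?_, ?_⟩
  · rw [hlin, hK, hdat]; linarith
  · rw [hcpl]; linarith

/-! ### §2 The perturbed resolvent on the complex pivot space -/

/-- The `ℝ`-linear perturbed resolvent (`0` outside `Re σ > −m`). [folklore] -/
def resolventRK (hL : 0 < L) (K : Esp L hL →L[ℝ] W L) (h : GardingDataK L hL d V K D₀ D₁ V₀ m) (σ : ℂ) : Wc L →L[ℝ] Wc L :=
  if hσ : -m < σ.re then (ofPair L).comp ((ιpair hL).comp ((pairOpK hL K h σ hσ).comp (toPair L))) else 0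

/-- Formula for `resolventRK` inside the half-plane. [folklore] -/
theorem resolventRK_apply (hL : 0 < L) (K : Esp L hL →L[ℝ] W L) (h : GardingDataK L hL d V K D₀ D₁ V₀ m) {σ : ℂ} (hσ : -m < σ.re)
    (G : Wc L) : resolventRK hL K h σ G = ofPair L (ιpair hL (pairOpK hL K h σ hσ (toPair L G))) := by
  rw [resolventRK, dif_pos hσ]; rfl

/-- `resolventRK σ = 0` outside the half-plane. [folklore] -/
theorem resolventRK_of_not (hL : 0 < L) (K : Esp L hL →L[ℝ] W L) (h : GardingDataK L hL d V K D₀ D₁ V₀ m) {σ : ℂ} (hσ : ¬ -m < σ.re) :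
    resolventRK hL K h σ = 0 := by
  rw [resolventRK, dif_neg hσ]

/-- `resolventRK σ` commutes with multiplication by `i`. [folklore] -/
theorem resolventRK_I_smul (hL : 0 < L) (K : Esp L hL →L[ℝ] W L) (h : GardingDataK L hL d V K D₀ D₁ V₀ m) (σ : ℂ) (G : Wc L) :
    resolventRK hL K h σ ((Complex.I : ℂ) • G) = (Complex.I : ℂ) • resolventRK hL K h σ G := by
  by_cases hσ : -m < σ.re
  · rw [resolventRK_apply hL K h hσ, resolventRK_apply hL K h hσ]
    have hrot : toPair L ((Complex.I : ℂ) • G) = WithLp.toLp 2 (-(toPair L G).snd, (toPair L G).fst) :=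
      WithLp.ofLp_injective 2 (Prod.ext (toPair_I_smul G).1 (toPair_I_smul G).2)
    rw [hrot, pairOpK_rot hL K h σ hσ]
    set Q := pairOpK hL K h σ hσ (toPair L G)
    have hι : ιpair hL (WithLp.toLp 2 (-Q.snd, Q.fst)) = WithLp.toLp 2 (-(ιpair hL Q).snd, (ιpair hL Q).fst) := by
      obtain ⟨h1, h2⟩ := ιpair_fst_snd hL Q
      obtain ⟨h1', h2'⟩ := ιpair_fst_snd hL (WithLp.toLp 2 (-Q.snd, Q.fst) : WithLp 2 (Esp L hL × Esp L hL))
      refine WithLp.ofLp_injective 2 (Prod.ext ?_ ?_)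
      · show (ιpair hL (WithLp.toLp 2 (-Q.snd, Q.fst))).fst = -(ιpair hL Q).snd
        rw [h1', h2]; exact map_neg (ιE hL) Q.snd
      · show (ιpair hL (WithLp.toLp 2 (-Q.snd, Q.fst))).snd = (ιpair hL Q).fst
        rw [h2', h1]; rfl
    rw [hι, ofPair_rot]
  · rw [resolventRK_of_not hL K h hσ]; simp

/-- **THE PERTURBED RESOLVENT** `R_K(σ) : L²_w(ℂ) →L[ℂ] L²_w(ℂ)` of `(−∂² + d∂ + V) + K` (`ℂ`-linear; `0` outside `Re σ > −m`). [folklore] -/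
def resolventK (hL : 0 < L) (K : Esp L hL →L[ℝ] W L) (h : GardingDataK L hL d V K D₀ D₁ V₀ m) (σ : ℂ) : Wc L →L[ℂ] Wc L :=
  toComplexCLM (resolventRK hL K h σ) (resolventRK_I_smul hL K h σ)

/-- `resolventK σ` acts as `resolventRK σ`. [folklore] -/
theorem resolventK_apply (hL : 0 < L) (K : Esp L hL →L[ℝ] W L) (h : GardingDataK L hL d V K D₀ D₁ V₀ m) (σ : ℂ) (G : Wc L) :
    resolventK hL K h σ G = resolventRK hL K h σ G := rfl

/-- **Weak meaning of the perturbed resolvent** (`Re σ > −m`): `resolventK σ G = ofPair (ιE p_R, ιE p_I)` with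
`(p_R, p_I) = pairOpK σ (Re G, Im G)`, `Re/Im R_K(σ)G = prim (der p_•)` a.e., and the profiles solve the perturbed pair system with data
`(Re G, Im G)`. [folklore] -/
theorem resolventK_weak (hL : 0 < L) (K : Esp L hL →L[ℝ] W L) (h : GardingDataK L hL d V K D₀ D₁ V₀ m) {σ : ℂ} (hσ : -m < σ.re)
    (G : Wc L) :
    resolventK hL K h σ G = ofPair L (ιpair hL (pairOpK hL K h σ hσ (toPair L G))) ∧
      (((reW L (resolventK hL K h σ G) : W L) : ℝ → ℝ) =ᵐ[volume] prim (der (pairOpK hL K h σ hσ (toPair L G)).fst)) ∧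
      (((imW L (resolventK hL K h σ G) : W L) : ℝ → ℝ) =ᵐ[volume] prim (der (pairOpK hL K h σ hσ (toPair L G)).snd)) ∧
      ∀ v v₁ : ℝ → ℝ, IsCompactTest v v₁ →
        linForm L d (fun ξ => V ξ + σ.re) (prim (der (pairOpK hL K h σ hσ (toPair L G)).fst)) (der (pairOpK hL K h σ hσ (toPair L G)).fst) v v₁
              + (∫ y, (L ^ 2 + y ^ 2) * (((K (pairOpK hL K h σ hσ (toPair L G)).fst : W L) : ℝ → ℝ) y * v y))
              - σ.im * ∫ y, (L ^ 2 + y ^ 2) * (prim (der (pairOpK hL K h σ hσ (toPair L G)).snd) y * v y) =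
            ∫ y, (L ^ 2 + y ^ 2) * (((reW L G : W L) : ℝ → ℝ) y * v y) ∧
          linForm L d (fun ξ => V ξ + σ.re) (prim (der (pairOpK hL K h σ hσ (toPair L G)).snd)) (der (pairOpK hL K h σ hσ (toPair L G)).snd) v v₁
              + (∫ y, (L ^ 2 + y ^ 2) * (((K (pairOpK hL K h σ hσ (toPair L G)).snd : W L) : ℝ → ℝ) y * v y))
              + σ.im * ∫ y, (L ^ 2 + y ^ 2) * (prim (der (pairOpK hL K h σ hσ (toPair L G)).fst) y * v y) =
            ∫ y, (L ^ 2 + y ^ 2) * (((imW L G : W L) : ℝ → ℝ) y * v y) := by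
  have happ : resolventK hL K h σ G = ofPair L (ιpair hL (pairOpK hL K h σ hσ (toPair L G))) := by
    rw [resolventK_apply, resolventRK_apply hL K h hσ]
  set Q := pairOpK hL K h σ hσ (toPair L G) with hQ
  have hpair : toPair L (resolventK hL K h σ G) = ιpair hL Q := by rw [happ, toPair_ofPair]
  obtain ⟨hc1, hc2⟩ := toPair_fst_snd (resolventK hL K h σ G)
  obtain ⟨hi1, hi2⟩ := ιpair_fst_snd hL Q
  refine ⟨happ, ?_, ?_, fun v v₁ hv => (pairOpK_spec hL K h σ hσ).1 (toPair L G) v v₁ hv⟩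
  · rw [← hc1, hpair, hi1]; exact ιE_ae hL Q.fst
  · rw [← hc2, hpair, hi2]; exact ιE_ae hL Q.snd

/-- **Norm bound**: `‖resolventK σ G‖ ≤ (8/κ(σ))‖G‖` on the half-plane. [folklore] -/
theorem norm_resolventK_le (hL : 0 < L) (K : Esp L hL →L[ℝ] W L) (h : GardingDataK L hL d V K D₀ D₁ V₀ m) {σ : ℂ} (hσ : -m < σ.re)
    (G : Wc L) : ‖resolventK hL K h σ G‖ ≤ 8 / min 1 (4 * (m + σ.re)) * ‖G‖ := by
  obtain ⟨happ, -, -, -⟩ := resolventK_weak hL K h hσ G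
  rw [happ, norm_ofPair]
  have h1 := norm_ιpair_le hL (pairOpK hL K h σ hσ (toPair L G))
  have h2 := (pairOpK_spec hL K h σ hσ).2 (toPair L G)
  rw [norm_toPair] at h2
  calc ‖ιpair hL (pairOpK hL K h σ hσ (toPair L G))‖ ≤ 2 * ‖pairOpK hL K h σ hσ (toPair L G)‖ := h1
    _ ≤ 2 * (4 / min 1 (4 * (m + σ.re)) * ‖G‖) := by gcongr
    _ = 8 / min 1 (4 * (m + σ.re)) * ‖G‖ := by ring

end SheetRPerturbedResolvent
end Summit.NavierStokesRegularity.OSWSelfSimilar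

end
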